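import Literature.MathematicalPhysics.QuantumLattice.TorusTestPotential
import Literature.MathematicalPhysics.QuantumLattice.LatticeToriProofs
import HarnessLib

/-!
# Outward nearest-neighbour bonds between consecutive `ℓ^∞`-shells of the discrete torus `(ℤ/Lℤ)²`

Trunk T-QLATTICE (family `hubbard`; consumer: the logarithmic dipole potential behind the sharp
exponent of the Koma–Tasaki pair-correlation bound,
`Summits/HubbardSuperconductivity/HubbardLadder/Bounds/PairCorrelationEtaLineDipole.lean`).

McBryan–Spencer's and Koma–Tasaki's logarithmic test potentials `φ(u) = q H(min(‖u - y‖, ρ))`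
(`H` = harmonic numbers) have nearest-neighbour differences `q/(s+1)` exactly on the bonds joining
the `ℓ^∞`-shell `S_s = {‖z‖_∞ = s}` to the next shell `S_{s+1}`, so their Dirichlet-type energy
`Σ_{u∼v} (cosh(φ_u - φ_v) - 1)` is governed by the number `N_s` of such bonds (Koma–Tasaki's
property P2 in the proof of their eq. (13)). The crude count `N_s ≤ 4 · #S_s ≤ 16(2s+1)` (every
site has `≤ 4` neighbours; `TorusTestPotential.lean`) loses a factor `4` against the truth; this
file proves the sharp count

* `sum_card_outward_le` — `N_s = Σ_{‖z‖ = s} #{w ∼ z : ‖w‖ = s + 1} ≤ 8s + 4` for every `s` and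
  every `L ≥ 1` (equality for `1 ≤ s < L/2 - 1`, where `S_s` is the boundary of a square of side
  `2s+1` with `4(2s+1)` outgoing bonds),

via: an outward bond at `z` leaves along a coordinate `i` with `|z_i| = ‖z‖` (cyclic absolute
value), and along such a coordinate at most one of `z ± e_i` is outward, because the cyclic absolute
value `k ↦ min(k, L - k)` has no strict local minimum with a positive value; whence
`#{outward bonds at z} ≤ #{i : |z_i| = ‖z‖}` and the shell sum is bounded coordinate-wise by
`#{a : |a| = s} · #{b : |b| ≤ s} ≤ 2(2s+1)` per coordinate. Also recorded: translation
invariance of the torus graph (`torusGraph_adj_sub_right_iff`).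

Sources: T. Koma, H. Tasaki, PRL 68 (1992) 3248, proof of eq. (13) (properties P1, P2 of the
dipole potential); O. A. McBryan, T. Spencer, Commun. Math. Phys. 53 (1977) 299;
S. Friedli, Y. Velenik, *Statistical Mechanics of Lattice Systems* (CUP 2017), §3.1 (torus,
translation invariance).

## Mathlib search

Mathlib has `ZMod.val_add`, `ZMod.val_injective`, `Finset.card_le_card_of_injOn`,
`Finset.card_filter`, but no discrete-torus geometry; the torus norm / distance / graph are the
tree's (`LatticeTori.lean`, `LatticeGraph.lean`, `TorusTestPotential.lean`).
-/

namespace Literature.MathematicalPhysics.QuantumLattice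

open Finset Literature.Probability.LatticeModels

variable {L : ℕ} [NeZero L]

/-! ### The cyclic absolute value along one coordinate -/

/-- The representative of `a + 1` in `ℤ/Lℤ`: either `val a + 1 < L` and `val (a+1) = val a + 1`,
or `val a + 1 = L` and `val (a+1) = 0`. [folklore] -/
private theorem val_add_one_cases (a : ZMod L) :
    ((a + 1).val = a.val + 1 ∧ a.val + 1 < L) ∨ ((a + 1).val = 0 ∧ a.val + 1 = L) := by
  have ha : a.val < L := ZMod.val_lt a
  rcases Nat.lt_or_ge 1 L with hL | hL
  · have h1 : (1 : ZMod L).val = 1 := by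
      rw [ZMod.val_one_eq_one_mod, Nat.mod_eq_of_lt hL]
    have hv : (a + 1).val = (a.val + 1) % L := by rw [ZMod.val_add, h1]
    rcases Nat.lt_or_ge (a.val + 1) L with hlt | hge
    · left
      rw [hv, Nat.mod_eq_of_lt hlt]
      exact ⟨rfl, hlt⟩
    · right
      have hEq : a.val + 1 = L := le_antisymm ha hge
      rw [hv, hEq, Nat.mod_self]
      exact ⟨rfl, rfl⟩
  · have hL1 : L = 1 := le_antisymm hL (Nat.one_le_iff_ne_zero.mpr (NeZero.ne L))
    have hb : (a + 1).val < L := ZMod.val_lt _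
    right
    omega

/-- The cyclic absolute value `k ↦ min(k, L - k)` on `ℤ/Lℤ` has no strict local minimum with a
positive value: if `|b + 1| < |b|` and `|b + 1| < |b + 2|` then `|b + 1| = 0`. [folklore] -/
private theorem cyclicAbs_eq_zero_of_strict_local_min (b : ZMod L)
    (h1 : min (b + 1).val (L - (b + 1).val) < min b.val (L - b.val))
    (h2 : min (b + 1).val (L - (b + 1).val) < min (b + 1 + 1).val (L - (b + 1 + 1).val)) :
    min (b + 1).val (L - (b + 1).val) = 0 := by
  have hb : b.val < L := ZMod.val_lt b
  have c1 := val_add_one_cases b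
  have c2 := val_add_one_cases (b + 1)
  omega

/-- Along a step `b = a + 1` or `a = b + 1` the cyclic absolute values differ by at most `1`.
[folklore] -/
private theorem cyclicAbs_step_le {a b : ZMod L} (h : b = a + 1 ∨ a = b + 1) :
    min b.val (L - b.val) ≤ min a.val (L - a.val) + 1 ∧
      min a.val (L - a.val) ≤ min b.val (L - b.val) + 1 := by
  rcases h with rfl | rfl
  · exact min_val_add_one_le L a
  · exact ⟨(min_val_add_one_le L b).2, (min_val_add_one_le L b).1⟩

/-! ### Outward bonds at one site of `(ℤ/Lℤ)²` -/

omit [NeZero L] in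
/-- A step `w = z ± e_i` in `(ℤ/Lℤ)²` changes the `i`-th coordinate by `±1` and no other. [folklore] -/
private theorem apply_of_step {z w : TorusSite 2 L} {i : Fin 2}
    (hw : w = z + Pi.single i 1 ∨ z = w + Pi.single i 1) :
    (w i = z i + 1 ∨ z i = w i + 1) ∧ ∀ j, j ≠ i → w j = z j := by
  rcases hw with rfl | rfl
  · exact ⟨Or.inl (by simp), fun j hj => by simp [Pi.single_eq_of_ne hj]⟩
  · exact ⟨Or.inr (by simp), fun j hj => by simp [Pi.single_eq_of_ne hj]⟩

/-- If `w = z ± e_i` lies on the next `ℓ^∞`-shell (`‖w‖ = ‖z‖ + 1`), then the step was taken along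
a maximal coordinate: `|z_i| = ‖z‖` and `|w_i| = ‖z‖ + 1`. [folklore] -/
private theorem coord_of_outward {z w : TorusSite 2 L} {i : Fin 2}
    (hw : w = z + Pi.single i 1 ∨ z = w + Pi.single i 1) (hn : torusNorm w = torusNorm z + 1) :
    min (z i).val (L - (z i).val) = torusNorm z ∧
      min (w i).val (L - (w i).val) = torusNorm z + 1 := by
  obtain ⟨hstep, hother⟩ := apply_of_step hw
  have hlip := cyclicAbs_step_le hstep
  rw [torusNorm_two_eq_max, torusNorm_two_eq_max] at hn
  rw [torusNorm_two_eq_max L z]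
  have hi2 : i = 0 ∨ i = 1 := by fin_cases i <;> simp
  rcases hi2 with rfl | rfl
  · have h1 : w 1 = z 1 := hother 1 (by decide)
    rw [h1] at hn
    constructor <;> omega
  · have h0 : w 0 = z 0 := hother 0 (by decide)
    rw [h0] at hn
    constructor <;> omega

/-- **At most one outward bond per maximal coordinate.** For `z ∈ (ℤ/Lℤ)²` with `‖z‖ ≥ 1`, the
number of neighbours `w ∼ z` on the next shell `‖w‖ = ‖z‖ + 1` is at most the number of
coordinates `i` with `|z_i| = ‖z‖` (along such a coordinate `z + e_i` and `z - e_i` cannot both be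
outward, since `|·|` has no positive strict local minimum). Koma–Tasaki, PRL 68 (1992) 3248, proof
of eq. (13), property P2. [cite: KomaTasakiPRL1992, proof of eq. (13) (P2)] -/
theorem card_outward_le_card_coord (z : TorusSite 2 L) (hz : 1 ≤ torusNorm z) :
    #{w : TorusSite 2 L | (torusGraph 2 L).Adj z w ∧ torusNorm w = torusNorm z + 1} ≤
      #{i : Fin 2 | min (z i).val (L - (z i).val) = torusNorm z} := by
  classical
  let g : Fin 2 → TorusSite 2 L := fun i =>
    if torusNorm (z + Pi.single i 1) = torusNorm z + 1 then z + Pi.single i 1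
    else z - Pi.single i 1
  calc #{w : TorusSite 2 L | (torusGraph 2 L).Adj z w ∧ torusNorm w = torusNorm z + 1}
      ≤ #((univ.filter fun i : Fin 2 => min (z i).val (L - (z i).val) = torusNorm z).image g) := by
        refine card_le_card fun w hw => ?_
        simp only [mem_filter, mem_univ, true_and] at hw
        obtain ⟨hadj, hn⟩ := hw
        rw [torusGraph_adj_iff] at hadj
        obtain ⟨i, hi⟩ : ∃ i : Fin 2, w = z + Pi.single i 1 ∨ z = w + Pi.single i 1 := by
          rcases hadj.2 with ⟨i, hi⟩ | ⟨i, hi⟩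
          · exact ⟨i, Or.inl hi⟩
          · exact ⟨i, Or.inr hi⟩
        obtain ⟨hzi, hwi⟩ := coord_of_outward hi hn
        refine mem_image.2 ⟨i, mem_filter.2 ⟨mem_univ _, hzi⟩, ?_⟩
        rcases hi with hi | hi
        · have ht : torusNorm (z + Pi.single i 1) = torusNorm z + 1 := by rw [← hi]; exact hn
          simp only [g, if_pos ht, hi]
        · have hw' : w = z - Pi.single i 1 := eq_sub_of_add_eq hi.symm
          have hf : ¬ torusNorm (z + Pi.single i 1) = torusNorm z + 1 := by
            intro ht
            -- both `z - e_i = w` and `z + e_i` outward: `|·|` would have a positive strict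
            -- local minimum at `z_i`
            obtain ⟨-, hpi⟩ := coord_of_outward (w := z + Pi.single i 1) (Or.inl rfl) ht
            have hzw : z i = w i + 1 := by rw [hi]; simp
            have hpi' : min (w i + 1 + 1).val (L - (w i + 1 + 1).val) = torusNorm z + 1 := by
              have : (z + Pi.single i 1 : TorusSite 2 L) i = w i + 1 + 1 := by simp [hzw]
              rw [this] at hpi
              exact hpi
            rw [hzw] at hzi
            have h0 := cyclicAbs_eq_zero_of_strict_local_min (w i) (by omega) (by omega)
            omega
          simp only [g, if_neg hf, hw']
    _ ≤ #{i : Fin 2 | min (z i).val (L - (z i).val) = torusNorm z} := card_image_le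

/-! ### The shell sum -/

/-- Sites of the shell `‖z‖ = s` whose FIRST coordinate is maximal (`|z_0| = s`) inject into
`{s, L - s} × ({0,…,s} ∪ {L-s,…,L-1})` under `z ↦ (val z_0, val z_1)`: at most `2(2s+1)` of them.
[folklore] -/
private theorem card_shell_fst_le (s : ℕ) :
    #{z : TorusSite 2 L | torusNorm z = s ∧ min (z 0).val (L - (z 0).val) = s} ≤
      2 * (2 * s + 1) := by
  classical
  set T : Finset ℕ := {s, L - s} with hT
  set S : Finset ℕ := range (s + 1) ∪ Ico (L - s) L with hS
  have hTc : #T ≤ 2 := card_insert_le _ _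
  have hSc : #S ≤ 2 * s + 1 := by
    calc #S ≤ #(range (s + 1)) + #(Ico (L - s) L) := card_union_le _ _
      _ ≤ 2 * s + 1 := by simp only [card_range, Nat.card_Ico]; omega
  calc #{z : TorusSite 2 L | torusNorm z = s ∧ min (z 0).val (L - (z 0).val) = s}
      ≤ #(T ×ˢ S) := by
        refine card_le_card_of_injOn (fun z => ((z 0).val, (z 1).val)) ?_ ?_
        · intro z hz
          simp only [coe_filter, mem_univ, true_and, Set.mem_setOf_eq] at hz
          obtain ⟨hn, h0⟩ := hz
          rw [torusNorm_two_eq_max] at hn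
          have h0L : (z 0).val < L := ZMod.val_lt _
          have h1L : (z 1).val < L := ZMod.val_lt _
          simp only [mem_coe, mem_product]
          exact ⟨val_mem_pair_of_min_eq h0L h0, val_mem_union_of_min_le h1L (by omega)⟩
        · intro z₁ _ z₂ _ h
          simp only [Prod.mk.injEq] at h
          funext i
          fin_cases i
          · exact ZMod.val_injective L h.1
          · exact ZMod.val_injective L h.2
    _ ≤ 2 * (2 * s + 1) := by
        rw [card_product]
        exact Nat.mul_le_mul hTc hSc

/-- Sites of the shell `‖z‖ = s` whose SECOND coordinate is maximal: at most `2(2s+1)` of them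
(as `card_shell_fst_le`, with the coordinates exchanged). [folklore] -/
private theorem card_shell_snd_le (s : ℕ) :
    #{z : TorusSite 2 L | torusNorm z = s ∧ min (z 1).val (L - (z 1).val) = s} ≤
      2 * (2 * s + 1) := by
  classical
  set T : Finset ℕ := {s, L - s} with hT
  set S : Finset ℕ := range (s + 1) ∪ Ico (L - s) L with hS
  have hTc : #T ≤ 2 := card_insert_le _ _
  have hSc : #S ≤ 2 * s + 1 := by
    calc #S ≤ #(range (s + 1)) + #(Ico (L - s) L) := card_union_le _ _
      _ ≤ 2 * s + 1 := by simp only [card_range, Nat.card_Ico]; omega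
  calc #{z : TorusSite 2 L | torusNorm z = s ∧ min (z 1).val (L - (z 1).val) = s}
      ≤ #(S ×ˢ T) := by
        refine card_le_card_of_injOn (fun z => ((z 0).val, (z 1).val)) ?_ ?_
        · intro z hz
          simp only [coe_filter, mem_univ, true_and, Set.mem_setOf_eq] at hz
          obtain ⟨hn, h1⟩ := hz
          rw [torusNorm_two_eq_max] at hn
          have h0L : (z 0).val < L := ZMod.val_lt _
          have h1L : (z 1).val < L := ZMod.val_lt _
          simp only [mem_coe, mem_product]
          exact ⟨val_mem_union_of_min_le h0L (by omega), val_mem_pair_of_min_eq h1L h1⟩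
        · intro z₁ _ z₂ _ h
          simp only [Prod.mk.injEq] at h
          funext i
          fin_cases i
          · exact ZMod.val_injective L h.1
          · exact ZMod.val_injective L h.2
    _ ≤ 2 * (2 * s + 1) := by
        rw [card_product, mul_comm]
        exact Nat.mul_le_mul hTc hSc

/-- On `(ℤ/Lℤ)²` only the origin has torus norm `0`. [folklore] -/
private theorem eq_zero_of_torusNorm_eq_zero {z : TorusSite 2 L} (h : torusNorm z = 0) : z = 0 := by
  rw [torusNorm_two_eq_max] at h
  have h0 : (z 0).val < L := ZMod.val_lt _
  have h1 : (z 1).val < L := ZMod.val_lt _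
  funext i
  fin_cases i
  · show z 0 = 0
    apply ZMod.val_injective L
    rw [ZMod.val_zero]
    omega
  · show z 1 = 0
    apply ZMod.val_injective L
    rw [ZMod.val_zero]
    omega

/-- **Outward bonds between consecutive `ℓ^∞`-shells of `(ℤ/Lℤ)²`.** For every `s` and every
`L ≥ 1`, the number of (ordered) nearest-neighbour bonds `z ∼ w` of the torus graph with
`‖z‖ = s`, `‖w‖ = s + 1` is at most `8s + 4 = 4(2s+1)` (the number of bonds leaving a square of
side `2s+1` in `ℤ²`; for `s = 0` the bound is the degree `4`). This is the lattice-geometric input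
(property P2) of the logarithmic dipole potential in Koma–Tasaki's proof of their eq. (13),
following McBryan–Spencer. [cite: KomaTasakiPRL1992, proof of eq. (13) (P2)] -/
theorem sum_card_outward_le (s : ℕ) :
    ∑ z ∈ univ.filter (fun z : TorusSite 2 L => torusNorm z = s),
        #{w : TorusSite 2 L | (torusGraph 2 L).Adj z w ∧ torusNorm w = s + 1} ≤ 8 * s + 4 := by
  classical
  rcases Nat.eq_zero_or_pos s with rfl | hs
  · have hsub : univ.filter (fun z : TorusSite 2 L => torusNorm z = 0) ⊆ {0} := by
      intro z hz
      simp only [mem_filter, mem_univ, true_and] at hz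
      rw [mem_singleton]
      exact eq_zero_of_torusNorm_eq_zero hz
    calc ∑ z ∈ univ.filter (fun z : TorusSite 2 L => torusNorm z = 0),
          #{w : TorusSite 2 L | (torusGraph 2 L).Adj z w ∧ torusNorm w = 0 + 1}
        ≤ ∑ z ∈ ({0} : Finset (TorusSite 2 L)),
            #{w : TorusSite 2 L | (torusGraph 2 L).Adj z w ∧ torusNorm w = 0 + 1} :=
          sum_le_sum_of_subset hsub
      _ = #{w : TorusSite 2 L | (torusGraph 2 L).Adj 0 w ∧ torusNorm w = 0 + 1} := sum_singleton _ _
      _ ≤ #{w : TorusSite 2 L | (torusGraph 2 L).Adj 0 w} :=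
          card_le_card fun w hw => by
            simp only [mem_filter, mem_univ, true_and] at hw ⊢
            exact hw.1
      _ ≤ 2 * 2 := card_filter_torusGraph_adj_le L 0
      _ = 8 * 0 + 4 := by norm_num
  · calc ∑ z ∈ univ.filter (fun z : TorusSite 2 L => torusNorm z = s),
          #{w : TorusSite 2 L | (torusGraph 2 L).Adj z w ∧ torusNorm w = s + 1}
        ≤ ∑ z ∈ univ.filter (fun z : TorusSite 2 L => torusNorm z = s),
            #{i : Fin 2 | min (z i).val (L - (z i).val) = s} := by
          refine sum_le_sum fun z hz => ?_
          simp only [mem_filter, mem_univ, true_and] at hz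
          have h := card_outward_le_card_coord z (by omega)
          rw [hz] at h
          exact h
      _ = ∑ z ∈ univ.filter (fun z : TorusSite 2 L => torusNorm z = s),
            ((if min (z 0).val (L - (z 0).val) = s then 1 else 0) +
              (if min (z 1).val (L - (z 1).val) = s then 1 else 0)) := by
          refine sum_congr rfl fun z _ => ?_
          rw [card_filter, Fin.sum_univ_two]
      _ = #{z : TorusSite 2 L | torusNorm z = s ∧ min (z 0).val (L - (z 0).val) = s} +
            #{z : TorusSite 2 L | torusNorm z = s ∧ min (z 1).val (L - (z 1).val) = s} := by
          rw [sum_add_distrib, sum_boole, sum_boole, filter_filter, filter_filter]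
          rfl
      _ ≤ 2 * (2 * s + 1) + 2 * (2 * s + 1) := Nat.add_le_add (card_shell_fst_le s) (card_shell_snd_le s)
      _ = 8 * s + 4 := by ring

/-! ### Translation invariance of the torus graph -/

omit [NeZero L] in
/-- The torus graph is translation invariant: `u - y ∼ v - y ↔ u ∼ v`.
Friedli–Velenik (2017), §3.1. [cite: FriedliVelenikSMLS2017, §3.1] -/
theorem torusGraph_adj_sub_right_iff {d : ℕ} (u v y : TorusSite d L) :
    (torusGraph d L).Adj (u - y) (v - y) ↔ (torusGraph d L).Adj u v := by
  simp only [torusGraph_adj_iff, ne_eq, sub_left_inj, sub_add_eq_add_sub]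

end Literature.MathematicalPhysics.QuantumLattice
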